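import Summits.QuantumFields.YangMills.Theorems.BalabanLadderNTBoundaryLawCore
import Summits.QuantumFields.YangMills.Theorems.BalabanLadderNTConditionalPackageCollar
import HarnessLib

/-!
# Crux `NT` (stmt-QuantumFields-19353), stub `stub_cfp : CFP`: the conditional clauses `FC2` / `FC3` on ORIGIN-based cubes

Helper file (`--supports stmt-QuantumFields-19353`) of the fleet lead prover of crux `NT` (unit `ym-spine-19353-p1`,
g2); an unconditional INTERFACE REDUCTION on the engine side of the registered stub `stub_cfp : CFP` (skeleton v2
«conditional-package», b5b471720c374849: `∃ (r, a)`, units ∧ `FBL ∧ FC2 ∧ FC3`), companion of the sibling files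
`…BoundaryLawCore` (`fbl_of_core`: the boundary law on origin-based cubes) and `…ConditionalPackageCollar`
(`fc2_of_antitoneCollar` / `fc3_of_antitoneCollar`: one antitone collar condition).

The registered two-point / three-point clauses `FC2 G r a`, `FC3 G r a`
(`Theorems/LangevinControlUVOSLegsFromFemtoAndGapDefs.lean` :150 / :161) quantify over every femto cube `(c, b)` of
`ℤ⁴`.  The cube kernels of the tree specification `ymSpecification` are translation covariant (tree
`ymSpecification_map_configShift`, sibling `kerE_configShift`), the action density is a translate of one local field
(`dens_configShift`) and `depth` is translation invariant (`depth_add`); so the conditional covariance `kerCov` and the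
conditional third cumulant `kerK3` of action densities are translation covariant (`kerCov_dens_configShift`,
`kerK3_configShift`), and ANY clause about a pair / triple of sites that only sees the depths, the conditional
covariance / cumulant and the difference vectors transports from the origin-based cubes `[0, b)⁴` to all cubes
(`pair_of_origin`, `triple_of_origin`).  Consequences for the engine's target:

* `fc2_of_core` — `FC2 G r a` follows from its restriction to origin-based cubes (`c = 0`), same witnesses;
* `fc3_of_core` — `FC3 G r a` likewise;
* `fc2_of_coreAntitone`, `fc3_of_coreAntitone` — origin-based cubes AND the single antitone-collar condition of
  `…ConditionalPackageCollar` at once (the net statements of the ENGINE TARGET memo, evidence #10 on the item).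
-/

set_option autoImplicit false

noncomputable section

open MeasureTheory Filter Topology
open Literature.MathematicalPhysics.QuantumFieldTheory Literature.MathematicalPhysics.QuantumLattice
open Literature.Probability.LatticeModels
open Summit.QuantumFields.YangMills.Cruxes.OSLegsFromFemtoAndGap.DlrCollarTransfer
open Summit.QuantumFields.YangMills.Cruxes.NT.BoundaryLaw
  (kerE_configShift dens_configShift depth_add configShift_configShift)

namespace Summit.QuantumFields.YangMills.Cruxes.NT.ConditionalPackage

/-! ## §1 Translation covariance of the conditional covariance and third cumulant -/

/-- Translating back and forth is the identity on configurations. [folklore] -/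
theorem configShift_neg_cancel {G : Type} [MeasurableSpace G] (v : Fin 4 → ℤ) (U : LGConfig 4 G) :
    configShift v (configShift (-v) U) = U := by
  rw [configShift_configShift, add_neg_cancel]
  funext e
  simp

section Kernel

variable (G : Type) [Group G] [TopologicalSpace G] [IsTopologicalGroup G] [CompactSpace G]
  [MeasurableSpace G] [BorelSpace G] (r : LatticeRep G)

/-- **Translation covariance of the conditional covariance of action densities** (cube, exterior and both sites
moved together). [folklore] -/
theorem kerCov_dens_configShift (v : Fin 4 → ℤ) (β : ℝ) (c : Fin 4 → ℤ) (b : ℕ) (η : LGConfig 4 G)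
    (x y : Fin 4 → ℤ) :
    kerCov G r β (c + v) b (configShift v η) (dens G r (x + v)) (dens G r (y + v)) =
      kerCov G r β c b η (dens G r x) (dens G r y) := by
  simp only [kerCov, kerE_configShift, Function.comp_def, dens_configShift]

/-- **Translation covariance of the conditional third cumulant of action densities**. [folklore] -/
theorem kerK3_configShift (v : Fin 4 → ℤ) (β : ℝ) (c : Fin 4 → ℤ) (b : ℕ) (η : LGConfig 4 G)
    (x y z : Fin 4 → ℤ) :
    kerK3 G r β (c + v) b (configShift v η) (x + v) (y + v) (z + v) = kerK3 G r β c b η x y z := by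
  simp only [kerK3, kerE_configShift, Function.comp_def, dens_configShift]

/-! ## §2 Pointwise transports from origin-based cubes -/

/-- Depth in a cube is depth of the translated site in the origin-based cube of the same side. [folklore] -/
theorem depth_eq_depth_origin (c : Fin 4 → ℤ) (b : ℕ) (x : Fin 4 → ℤ) : depth c b x = depth 0 b (x - c) := by
  have h := depth_add 0 c b (x - c)
  rw [zero_add, sub_add_cancel] at h
  exact h

/-- The conditional covariance of action densities in a cube is the one in the origin-based cube of the same side,
with translated exterior and sites. [folklore] -/
theorem kerCov_eq_kerCov_origin (β : ℝ) (c : Fin 4 → ℤ) (b : ℕ) (η : LGConfig 4 G) (x y : Fin 4 → ℤ) :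
    kerCov G r β c b η (dens G r x) (dens G r y) =
      kerCov G r β 0 b (configShift (-c) η) (dens G r (x - c)) (dens G r (y - c)) := by
  rw [← kerCov_dens_configShift G r c β 0 b (configShift (-c) η) (x - c) (y - c),
    configShift_neg_cancel, zero_add, sub_add_cancel, sub_add_cancel]

/-- The conditional third cumulant of action densities in a cube is the one in the origin-based cube of the same
side, with translated exterior and sites. [folklore] -/
theorem kerK3_eq_kerK3_origin (β : ℝ) (c : Fin 4 → ℤ) (b : ℕ) (η : LGConfig 4 G) (x y z : Fin 4 → ℤ) :
    kerK3 G r β c b η x y z = kerK3 G r β 0 b (configShift (-c) η) (x - c) (y - c) (z - c) := by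
  rw [← kerK3_configShift G r c β 0 b (configShift (-c) η) (x - c) (y - c) (z - c),
    configShift_neg_cancel, zero_add, sub_add_cancel, sub_add_cancel, sub_add_cancel]

/-- **Pair transport.**  A property of a pair of sites in a cube with exterior that only depends on the two depths,
the conditional covariance of the action densities and the difference vector holds in every cube as soon as it
holds in the origin-based cubes of the same side (for every exterior and every pair). [folklore] -/
theorem pair_of_origin (β : ℝ) (b : ℕ) (P : ℕ → ℕ → ℝ → (Fin 4 → ℤ) → Prop)
    (h : ∀ (η : LGConfig 4 G) (x y : Fin 4 → ℤ),
      P (depth 0 b x) (depth 0 b y) (kerCov G r β 0 b η (dens G r x) (dens G r y)) (y - x))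
    (c : Fin 4 → ℤ) (η : LGConfig 4 G) (x y : Fin 4 → ℤ) :
    P (depth c b x) (depth c b y) (kerCov G r β c b η (dens G r x) (dens G r y)) (y - x) := by
  rw [depth_eq_depth_origin c b x, depth_eq_depth_origin c b y, kerCov_eq_kerCov_origin G r β c b η x y,
    ← sub_sub_sub_cancel_right y x c]
  exact h _ _ _

/-- **Triple transport.**  The same for a property of a triple of sites that only depends on the three depths, the
conditional third cumulant of the action densities and the two difference vectors. [folklore] -/
theorem triple_of_origin (β : ℝ) (b : ℕ) (P : ℕ → ℕ → ℕ → ℝ → (Fin 4 → ℤ) → (Fin 4 → ℤ) → Prop)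
    (h : ∀ (η : LGConfig 4 G) (x y z : Fin 4 → ℤ),
      P (depth 0 b x) (depth 0 b y) (depth 0 b z) (kerK3 G r β 0 b η x y z) (y - x) (z - x))
    (c : Fin 4 → ℤ) (η : LGConfig 4 G) (x y z : Fin 4 → ℤ) :
    P (depth c b x) (depth c b y) (depth c b z) (kerK3 G r β c b η x y z) (y - x) (z - x) := by
  rw [depth_eq_depth_origin c b x, depth_eq_depth_origin c b y, depth_eq_depth_origin c b z,
    kerK3_eq_kerK3_origin G r β c b η x y z, ← sub_sub_sub_cancel_right y x c, ← sub_sub_sub_cancel_right z x c]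
  exact h _ _ _ _

/-! ## §3 The cores -/

/-- **Core form of `FC2`: origin-based cubes.**  The registered `FC2 G r a` follows from its restriction to the
origin-based femto cubes `[0, b)⁴` (`b · a β ≤ ℓ₂`), with the same witnesses `Γ, β₂, ℓ₂, c₂, C₂, K, n₀`. [folklore] -/
theorem fc2_of_core (a : ℝ → ℝ)
    (h : ∃ (Γ : ℝ → ℝ) (β₂ ℓ₂ c₂ C₂ : ℝ) (K : ℝ → ℝ) (n₀ : ℕ), 0 < ℓ₂ ∧ 0 < c₂ ∧ (∀ s, 1 ≤ K s) ∧
      Tendsto (fun s : ℝ => s * K s) (nhdsWithin 0 (Set.Ioi 0)) (nhds 0) ∧ 1 ≤ n₀ ∧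
      ContinuousOn Γ (Set.Ioc 0 ℓ₂) ∧ (∀ s : ℝ, 0 < s → s ≤ ℓ₂ → 0 < Γ s ∧ Γ s ≤ 1) ∧
      Tendsto (fun s : ℝ => Γ s / s ^ 8) (nhdsWithin 0 (Set.Ioi 0)) atTop ∧
      ∀ β : ℝ, β₂ ≤ β → ∀ b : ℕ, (b : ℝ) * a β ≤ ℓ₂ →
        ∀ (η : LGConfig 4 G) (x y : Fin 4 → ℤ) (s₀ : ℝ), 0 < s₀ → s₀ ≤ ‖siteToE (y - x)‖ * a β →
          (n₀ : ℝ) ≤ ‖siteToE (y - x)‖ → K s₀ * ‖siteToE (y - x)‖ ≤ depth 0 b x →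
          K s₀ * ‖siteToE (y - x)‖ ≤ depth 0 b y →
          c₂ * Γ (‖siteToE (y - x)‖ * a β) ≤ ‖siteToE (y - x)‖ ^ 8 * kerCov G r β 0 b η (dens G r x) (dens G r y) ∧
          ‖siteToE (y - x)‖ ^ 8 * kerCov G r β 0 b η (dens G r x) (dens G r y) ≤ C₂ * Γ (‖siteToE (y - x)‖ * a β)) :
    FC2 G r a := by
  obtain ⟨Γ, β₂, ℓ₂, c₂, C₂, K, n₀, hℓ₂, hc₂, hK1, hKlim, hn₀, hΓc, hΓ, hΓlim, H⟩ := h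
  refine ⟨Γ, β₂, ℓ₂, c₂, C₂, K, n₀, hℓ₂, hc₂, hK1, hKlim, hn₀, hΓc, hΓ, hΓlim, ?_⟩
  intro β hβ c b hb η x y
  exact pair_of_origin G r β b (fun dx dy cov w => ∀ s₀ : ℝ, 0 < s₀ → s₀ ≤ ‖siteToE w‖ * a β →
      (n₀ : ℝ) ≤ ‖siteToE w‖ → K s₀ * ‖siteToE w‖ ≤ dx → K s₀ * ‖siteToE w‖ ≤ dy →
      c₂ * Γ (‖siteToE w‖ * a β) ≤ ‖siteToE w‖ ^ 8 * cov ∧ ‖siteToE w‖ ^ 8 * cov ≤ C₂ * Γ (‖siteToE w‖ * a β))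
    (H β hβ b hb) c η x y

/-- **Core form of `FC3`: origin-based cubes.**  The registered `FC3 G r a` follows from its restriction to the
origin-based femto cubes `[0, b)⁴` (`b · a β ≤ ℓ₃`), with the same witnesses. [folklore] -/
theorem fc3_of_core (a : ℝ → ℝ)
    (h : ∃ (v w : EuclideanSpace ℝ (Fin 4)) (σ δ : ℝ) (Γ₃ : ℝ → ℝ) (β₃ ℓ₃ c₃ : ℝ) (K₃ : ℝ → ℝ) (n₃ : ℕ),
      (σ = 1 ∨ σ = -1) ∧ 0 < δ ∧ 2 * δ < ‖v‖ ∧ 2 * δ < ‖w‖ ∧ 2 * δ < ‖v - w‖ ∧ 0 < ℓ₃ ∧ 0 < c₃ ∧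
      (∀ s, 1 ≤ K₃ s) ∧ Tendsto (fun s : ℝ => s * K₃ s) (nhdsWithin 0 (Set.Ioi 0)) (nhds 0) ∧ 1 ≤ n₃ ∧
      ContinuousOn Γ₃ (Set.Ioc 0 ℓ₃) ∧ (∀ s : ℝ, 0 < s → s ≤ ℓ₃ → 0 < Γ₃ s) ∧
      Tendsto (fun s : ℝ => Γ₃ s / s ^ 4) (nhdsWithin 0 (Set.Ioi 0)) atTop ∧
      ∀ β : ℝ, β₃ ≤ β → ∀ b : ℕ, (b : ℝ) * a β ≤ ℓ₃ →
        ∀ (η : LGConfig 4 G) (n : ℕ) (x y z : Fin 4 → ℤ) (s₀ : ℝ), 0 < s₀ → s₀ ≤ (n : ℝ) * a β → n₃ ≤ n →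
          ‖siteToE (y - x) - (n : ℝ) • v‖ ≤ δ * n → ‖siteToE (z - x) - (n : ℝ) • w‖ ≤ δ * n →
          K₃ s₀ * n ≤ depth 0 b x → K₃ s₀ * n ≤ depth 0 b y → K₃ s₀ * n ≤ depth 0 b z →
          c₃ * Γ₃ ((n : ℝ) * a β) ≤ σ * (n : ℝ) ^ 12 * kerK3 G r β 0 b η x y z) :
    FC3 G r a := by
  obtain ⟨v, w, σ, δ, Γ₃, β₃, ℓ₃, c₃, K₃, n₃, hσ, hδ, hv, hw, hvw, hℓ₃, hc₃, hK1, hKlim, hn₃, hΓc, hΓ, hΓlim, H⟩ :=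
    h
  refine ⟨v, w, σ, δ, Γ₃, β₃, ℓ₃, c₃, K₃, n₃, hσ, hδ, hv, hw, hvw, hℓ₃, hc₃, hK1, hKlim, hn₃, hΓc, hΓ, hΓlim, ?_⟩
  intro β hβ c b hb η n x y z
  exact triple_of_origin G r β b (fun dx dy dz k3 w₁ w₂ => ∀ s₀ : ℝ, 0 < s₀ → s₀ ≤ (n : ℝ) * a β → n₃ ≤ n →
      ‖siteToE w₁ - (n : ℝ) • v‖ ≤ δ * n → ‖siteToE w₂ - (n : ℝ) • w‖ ≤ δ * n →
      K₃ s₀ * n ≤ dx → K₃ s₀ * n ≤ dy → K₃ s₀ * n ≤ dz → c₃ * Γ₃ ((n : ℝ) * a β) ≤ σ * (n : ℝ) ^ 12 * k3)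
    (fun η' x' y' z' => H β hβ b hb η' n x' y' z') c η x y z

/-- **Net engine target for `FC2`: origin-based cubes, one antitone collar condition.**  The registered `FC2 G r a`
follows from: `K` antitone on `(0, ∞)` and the two-sided conditional two-point bounds on the ORIGIN-based femto cubes
under the SINGLE depth condition at the pair's own physical separation `K (‖y − x‖ · a β) · ‖y − x‖ ≤ depth` at `x`
and `y` (sibling `fc2_of_antitoneCollar` after `pair_of_origin`). [folklore] -/
theorem fc2_of_coreAntitone (a : ℝ → ℝ)
    (h : ∃ (Γ : ℝ → ℝ) (β₂ ℓ₂ c₂ C₂ : ℝ) (K : ℝ → ℝ) (n₀ : ℕ), 0 < ℓ₂ ∧ 0 < c₂ ∧ (∀ s, 1 ≤ K s) ∧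
      AntitoneOn K (Set.Ioi 0) ∧ Tendsto (fun s : ℝ => s * K s) (nhdsWithin 0 (Set.Ioi 0)) (nhds 0) ∧ 1 ≤ n₀ ∧
      ContinuousOn Γ (Set.Ioc 0 ℓ₂) ∧ (∀ s : ℝ, 0 < s → s ≤ ℓ₂ → 0 < Γ s ∧ Γ s ≤ 1) ∧
      Tendsto (fun s : ℝ => Γ s / s ^ 8) (nhdsWithin 0 (Set.Ioi 0)) atTop ∧
      ∀ β : ℝ, β₂ ≤ β → ∀ b : ℕ, (b : ℝ) * a β ≤ ℓ₂ →
        ∀ (η : LGConfig 4 G) (x y : Fin 4 → ℤ), (n₀ : ℝ) ≤ ‖siteToE (y - x)‖ → 0 < ‖siteToE (y - x)‖ * a β →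
          K (‖siteToE (y - x)‖ * a β) * ‖siteToE (y - x)‖ ≤ depth 0 b x →
          K (‖siteToE (y - x)‖ * a β) * ‖siteToE (y - x)‖ ≤ depth 0 b y →
          c₂ * Γ (‖siteToE (y - x)‖ * a β) ≤ ‖siteToE (y - x)‖ ^ 8 * kerCov G r β 0 b η (dens G r x) (dens G r y) ∧
          ‖siteToE (y - x)‖ ^ 8 * kerCov G r β 0 b η (dens G r x) (dens G r y) ≤ C₂ * Γ (‖siteToE (y - x)‖ * a β)) :
    FC2 G r a := by
  obtain ⟨Γ, β₂, ℓ₂, c₂, C₂, K, n₀, hℓ₂, hc₂, hK1, hKanti, hKlim, hn₀, hΓc, hΓ, hΓlim, H⟩ := h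
  refine fc2_of_antitoneCollar G r a
    ⟨Γ, β₂, ℓ₂, c₂, C₂, K, n₀, hℓ₂, hc₂, hK1, hKanti, hKlim, hn₀, hΓc, hΓ, hΓlim, ?_⟩
  intro β hβ c b hb η x y
  exact pair_of_origin G r β b (fun dx dy cov w' => (n₀ : ℝ) ≤ ‖siteToE w'‖ → 0 < ‖siteToE w'‖ * a β →
      K (‖siteToE w'‖ * a β) * ‖siteToE w'‖ ≤ dx → K (‖siteToE w'‖ * a β) * ‖siteToE w'‖ ≤ dy →
      c₂ * Γ (‖siteToE w'‖ * a β) ≤ ‖siteToE w'‖ ^ 8 * cov ∧ ‖siteToE w'‖ ^ 8 * cov ≤ C₂ * Γ (‖siteToE w'‖ * a β))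
    (H β hβ b hb) c η x y

/-- **Net engine target for `FC3`: origin-based cubes, one antitone collar condition** (sibling
`fc3_of_antitoneCollar` after `triple_of_origin`). [folklore] -/
theorem fc3_of_coreAntitone (a : ℝ → ℝ)
    (h : ∃ (v w : EuclideanSpace ℝ (Fin 4)) (σ δ : ℝ) (Γ₃ : ℝ → ℝ) (β₃ ℓ₃ c₃ : ℝ) (K₃ : ℝ → ℝ) (n₃ : ℕ),
      (σ = 1 ∨ σ = -1) ∧ 0 < δ ∧ 2 * δ < ‖v‖ ∧ 2 * δ < ‖w‖ ∧ 2 * δ < ‖v - w‖ ∧ 0 < ℓ₃ ∧ 0 < c₃ ∧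
      (∀ s, 1 ≤ K₃ s) ∧ AntitoneOn K₃ (Set.Ioi 0) ∧
      Tendsto (fun s : ℝ => s * K₃ s) (nhdsWithin 0 (Set.Ioi 0)) (nhds 0) ∧ 1 ≤ n₃ ∧
      ContinuousOn Γ₃ (Set.Ioc 0 ℓ₃) ∧ (∀ s : ℝ, 0 < s → s ≤ ℓ₃ → 0 < Γ₃ s) ∧
      Tendsto (fun s : ℝ => Γ₃ s / s ^ 4) (nhdsWithin 0 (Set.Ioi 0)) atTop ∧
      ∀ β : ℝ, β₃ ≤ β → ∀ b : ℕ, (b : ℝ) * a β ≤ ℓ₃ →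
        ∀ (η : LGConfig 4 G) (n : ℕ) (x y z : Fin 4 → ℤ), n₃ ≤ n → 0 < (n : ℝ) * a β →
          ‖siteToE (y - x) - (n : ℝ) • v‖ ≤ δ * n → ‖siteToE (z - x) - (n : ℝ) • w‖ ≤ δ * n →
          K₃ ((n : ℝ) * a β) * n ≤ depth 0 b x → K₃ ((n : ℝ) * a β) * n ≤ depth 0 b y →
          K₃ ((n : ℝ) * a β) * n ≤ depth 0 b z →
          c₃ * Γ₃ ((n : ℝ) * a β) ≤ σ * (n : ℝ) ^ 12 * kerK3 G r β 0 b η x y z) :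
    FC3 G r a := by
  obtain ⟨v, w, σ, δ, Γ₃, β₃, ℓ₃, c₃, K₃, n₃, hσ, hδ, hv, hw, hvw, hℓ₃, hc₃, hK1, hKanti, hKlim, hn₃, hΓc, hΓ,
    hΓlim, H⟩ := h
  refine fc3_of_antitoneCollar G r a ⟨v, w, σ, δ, Γ₃, β₃, ℓ₃, c₃, K₃, n₃, hσ, hδ, hv, hw, hvw, hℓ₃, hc₃, hK1,
    hKanti, hKlim, hn₃, hΓc, hΓ, hΓlim, ?_⟩
  intro β hβ c b hb η n x y z
  exact triple_of_origin G r β b (fun dx dy dz k3 w₁ w₂ => n₃ ≤ n → 0 < (n : ℝ) * a β →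
      ‖siteToE w₁ - (n : ℝ) • v‖ ≤ δ * n → ‖siteToE w₂ - (n : ℝ) • w‖ ≤ δ * n →
      K₃ ((n : ℝ) * a β) * n ≤ dx → K₃ ((n : ℝ) * a β) * n ≤ dy → K₃ ((n : ℝ) * a β) * n ≤ dz →
      c₃ * Γ₃ ((n : ℝ) * a β) ≤ σ * (n : ℝ) ^ 12 * k3)
    (fun η' x' y' z' => H β hβ b hb η' n x' y' z') c η x y z

end Kernel

end Summit.QuantumFields.YangMills.Cruxes.NT.ConditionalPackage

end
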